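import Literature.Probability.RandomPlanarGeometry.SAWPulledMeanExtension
import Literature.Probability.RandomPlanarGeometry.SAWPulledRenewalGapTilts
import Literature.Probability.RandomPlanarGeometry.SAWPulledFreeEnergyZ2Sharp
import Literature.Probability.RandomPlanarGeometry.SAWLowerBound2604
import HarnessLib

/-!
# The `ℤ²` force–extension staircase for pulled bridges (computational edition)

Topic `Literature/Probability/RandomPlanarGeometry` (continues `SAWPulledMeanExtension.lean`). From the certified
free-energy windows at the tilts `1, 11/9, 3/2, 25/16, 125/64, 2, 3, 256/81, 4` and the convexity of
`s ↦ λ_B(e^s)`: two-sided rational bounds on every secant of Beaton's pulled-bridge free energy between consecutive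
tilts, hence on the one-sided derivatives (the asymptotic extension per step `v(s±)`) and on the mean span per step
`E^{B,y}_N[span]/N` for large `N`:

| force `y₀` | `v(log y₀ -) ≤ ` | `v(log y₀ +) ≥` | source windows |
|---|---|---|---|
| `1` | — | `0`; and `v(0+) ≤ 5/13` | `μ ∈ [2.604, 2.688]`, `U_{11/9}` |
| `11/9` | `8/17` | `5/26` | `L_{11/9} = 10⁴/3577`, `U_1`, `U_{3/2}` |
| `3/2` | `10/19` | `7/16` | `L = 10⁴/3251`, `U_{11/9}`, `U_{25/16}` |
| `25/16` | `5/9` | `24/49` | `L = 10⁴/3184`, `U_{3/2}`, `U_{125/64}` |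
| `125/64` | `3/5` | `6/11` | `L = 10⁴/2815`, `U_{25/16}`, `U_2` |
| `2` | `16/25` | `15/26` | `L = 1250/347`, `U_{125/64}`, `U_3` |
| `3` | `20/29` | `19/30` | `L = 10⁴/2145`, `U_2`, `U_{256/81}` |
| `256/81` | `5/7` | `2/3` | `L = 10⁴/2070`, `U_3`, `U_4` |
| `4` | `1` | `12/17` | `L = 10⁴/1752`, `U_{256/81}` |

(the row `2` refines the window `[4/7, 9/14]` of `SAWPulledForceExtensionZ2.lean` — a-p6, the same two enclosures
with the coarser exponents of route R43 — to `[15/26, 16/25]`; true window secants, for comparison: `0.3828, [0.1957, 0.4706], [0.4383, 0.5253], [0.4904, 0.5531],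
[0.5492, 0.5965], [0.5780, 0.6366], [0.6355, 0.6878], [0.6784, 0.7103], [0.7070, 1]`; series estimate
`v(log 2) ≈ 0.605`, a-ref-2 g14: `E^{B,2}_{32}[span]/32 = 0.6054`). The mean-span windows are EVENTUAL
(`N ≥ N₀(ε)`), not all-`N`: in the exact census to `N = 32` (a-ref-2 g15) `E_N/N` decreases in `N` at every tilt and
is still above the upper edge at `y = 1` (0.3962 vs 5/13) and `y = 3/2` (0.5315 vs 10/19), entry predicted near `N ≈ 36–37`.
Every certificate is a closed rational
inequality checked by `norm_num`; the windows themselves are `native_decide` facts of their home files, so this file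
is a declared computational edition. Lane «pcv-sawmu», a-idea-1 gen 10 (R43 «FORCE-EXT»), 2026-08-22.
[cite: Beaton2015, §2, Theorem 1; PonitzTittmann2000, §3; Jensen2004, §1]
-/

noncomputable section

open Finset Filter Topology Literature.Probability.LatticeModels
open Literature.Probability.RandomPlanarGeometry.SAW
open scoped BigOperators

namespace Literature.Probability.RandomPlanarGeometry.SAW.Zd

/-! ## §4 The `ℤ²` force–extension staircase (computational edition)

Certified free-energy windows `log L_y ≤ λ_B(y) ≤ log U_y` at the nine tilts
`y ∈ {1, 11/9, 3/2, 25/16, 125/64, 2, 3, 256/81, 4}` (`L_1 = 2.604 ≤ μ`, `U_1 = 2.688 ≥ μ`; the others from the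
span-1 Kraft sums `SAWPulledFreeEnergyZ2Sharp(Tilts)` and the width-16 one-sided finite-memory certificates
`SAWPulledFreeEnergyZ2(Tilts)`), read through §2: at each tilt `y₀` with neighbours `x < y₀ < z` the window secants
obey `p/q ≤ (λ_B(y₀) - λ_B(x))/log(y₀/x)` iff-certified by `(y₀/x)^p ≤ (L_{y₀}/U_x)^q` and
`(λ_B(z) - λ_B(y₀))/log(z/y₀) ≤ p'/q'` by `(U_z/L_{y₀})^{q'} ≤ (z/y₀)^{p'}` (`norm_num`), whence every right secant at
`y₀` is `≥ p/q`, every left secant is `≤ p'/q'`, and `E^{B,y₀}_N[span]/N ∈ [p/q - ε, p'/q' + ε]` for `N ≥ N₀(ε)`.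
The staircase (extension per step, i.e. the slope of `s ↦ λ_B(e^s)`):
`v(0⁺) ≤ 5/13`, `v(log 11/9 ±) ∈ [5/26, 8/17]`, `v(log 3/2 ±) ∈ [7/16, 10/19]`, `v(log 25/16 ±) ∈ [24/49, 5/9]`,
`v(log 125/64 ±) ∈ [6/11, 3/5]`, `v(log 2 ±) ∈ [15/26, 16/25]`, `v(log 3 ±) ∈ [19/30, 20/29]`,
`v(log 256/81 ±) ∈ [2/3, 5/7]`, `v(log 4 ±) ∈ [12/17, 1]`.
Computational edition: the windows rest on `native_decide` certificates (declared in their home files).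
-/

/-- The zero-force window `log 2.604 ≤ λ_B(1) = log μ ≤ log 2.688` (`ℤ²`).
[cite: Beaton2015, §2, eq. (2); Jensen2004, §1; PonitzTittmann2000, §3] -/
theorem freeEnergyWindow_one :
    Real.log (2604 / 1000) ≤ pulledBridgeFreeEnergy 2 1 ∧ pulledBridgeFreeEnergy 2 1 ≤ Real.log (2688 / 1000) := by
  have h1 : (2604 / 1000 : ℝ) ≤ connectiveConstant 2 := by
    have h := le_connectiveConstant_2604
    rw [connectiveConstant_two]
    norm_num at h ⊢
    exact h
  have h2 : connectiveConstant 2 ≤ 2688 / 1000 := by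
    have h := connectiveConstant_two_le_2688
    norm_num at h ⊢
    exact h
  refine ⟨?_, ?_⟩
  · rw [pulledBridgeFreeEnergy_one 1]
    exact Real.log_le_log (by norm_num) h1
  · exact pulledBridgeFreeEnergy_one_le_log 1 h2

/-- The free-energy window at the tilt `y = 11/9` (`ℤ²`): `log(10000 / 3577) ≤ λ_B(11/9) ≤ log(278379899 / 99000000)`
(span-1 Kraft lower bound; `Z^B ≤ Z` and the width-16 finite-memory certificate). Computational edition.
[cite: Beaton2015, Lemma 2, Theorem 1; PonitzTittmann2000, §3] -/
theorem freeEnergyWindow_r11_9 :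
    Real.log (10000 / 3577) ≤ pulledBridgeFreeEnergy 2 ((11 : ℝ) / 9) ∧
      pulledBridgeFreeEnergy 2 ((11 : ℝ) / 9) ≤ Real.log (278379899 / 99000000) :=
  ⟨log_le_pulledBridgeFreeEnergy_of_exists (by norm_num) (by norm_num) pulledBridgeZ_eleven_ninths_lower_sharp,
    pulledBridgeFreeEnergy_le_log_of_geometric 1 (y := ((11 : ℝ) / 9)) (C := 2 ^ 41) (by norm_num) (by norm_num)
      (by norm_num) fun N => (pulledBridgeZ_le_driftZ 2 N (by norm_num)).trans (driftZ_eleven_ninths_upper N)⟩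

/-- The free-energy window at the tilt `y = 3/2` (`ℤ²`): `log(10000 / 3251) ≤ λ_B(3/2) ≤ log(18470750 / 6000000)`
(span-1 Kraft lower bound; `Z^B ≤ Z` and the width-16 finite-memory certificate). Computational edition.
[cite: Beaton2015, Lemma 2, Theorem 1; PonitzTittmann2000, §3] -/
theorem freeEnergyWindow_r3_2 :
    Real.log (10000 / 3251) ≤ pulledBridgeFreeEnergy 2 ((3 : ℝ) / 2) ∧
      pulledBridgeFreeEnergy 2 ((3 : ℝ) / 2) ≤ Real.log (18470750 / 6000000) :=
  ⟨log_le_pulledBridgeFreeEnergy_of_exists (by norm_num) (by norm_num) pulledBridgeZ_three_halves_lower_sharp,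
    pulledBridgeFreeEnergy_le_log_of_geometric 1 (y := ((3 : ℝ) / 2)) (C := 2 ^ 41) (by norm_num) (by norm_num)
      (by norm_num) fun N => (pulledBridgeZ_le_driftZ 2 N (by norm_num)).trans (driftZ_three_halves_upper N)⟩

/-- The free-energy window at the tilt `y = 25/16` (`ℤ²`): `log(10000 / 3184) ≤ λ_B(25/16) ≤ log(1257057670 / 400000000)`
(span-1 Kraft lower bound; `Z^B ≤ Z` and the width-16 finite-memory certificate). Computational edition.
[cite: Beaton2015, Lemma 2, Theorem 1; PonitzTittmann2000, §3] -/
theorem freeEnergyWindow_r25_16 :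
    Real.log (10000 / 3184) ≤ pulledBridgeFreeEnergy 2 ((25 : ℝ) / 16) ∧
      pulledBridgeFreeEnergy 2 ((25 : ℝ) / 16) ≤ Real.log (1257057670 / 400000000) :=
  ⟨log_le_pulledBridgeFreeEnergy_of_exists (by norm_num) (by norm_num) pulledBridgeZ_twentyfive_sixteenths_lower_sharp,
    pulledBridgeFreeEnergy_le_log_of_geometric 1 (y := ((25 : ℝ) / 16)) (C := 2 ^ 41) (by norm_num) (by norm_num)
      (by norm_num) fun N => (pulledBridgeZ_le_driftZ 2 N (by norm_num)).trans (driftZ_twentyfive_sixteenths_upper N)⟩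

/-- The free-energy window at the tilt `y = 125/64` (`ℤ²`): `log(10000 / 2815) ≤ λ_B(125/64) ≤ log(28426068191 / 8000000000)`
(span-1 Kraft lower bound; `Z^B ≤ Z` and the width-16 finite-memory certificate). Computational edition.
[cite: Beaton2015, Lemma 2, Theorem 1; PonitzTittmann2000, §3] -/
theorem freeEnergyWindow_r125_64 :
    Real.log (10000 / 2815) ≤ pulledBridgeFreeEnergy 2 ((125 : ℝ) / 64) ∧
      pulledBridgeFreeEnergy 2 ((125 : ℝ) / 64) ≤ Real.log (28426068191 / 8000000000) :=
  ⟨log_le_pulledBridgeFreeEnergy_of_exists (by norm_num) (by norm_num) pulledBridgeZ_r125_64_lower_sharp,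
    pulledBridgeFreeEnergy_le_log_of_geometric 1 (y := ((125 : ℝ) / 64)) (C := 2 ^ 41) (by norm_num) (by norm_num)
      (by norm_num) fun N => (pulledBridgeZ_le_driftZ 2 N (by norm_num)).trans (driftZ_r125_64_upper N)⟩

/-- The free-energy window at the tilt `y = 2` (`ℤ²`): `log(1250 / 347) ≤ λ_B(2) ≤ log(7206013 / 2000000)`
(span-1 Kraft lower bound; `Z^B ≤ Z` and the width-16 finite-memory certificate). Computational edition.
[cite: Beaton2015, Lemma 2, Theorem 1; PonitzTittmann2000, §3] -/
theorem freeEnergyWindow_two :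
    Real.log (1250 / 347) ≤ pulledBridgeFreeEnergy 2 (2 : ℝ) ∧
      pulledBridgeFreeEnergy 2 (2 : ℝ) ≤ Real.log (7206013 / 2000000) :=
  ⟨log_le_pulledBridgeFreeEnergy_of_exists (by norm_num) (by norm_num) pulledBridgeZ_two_lower_sharp,
    pulledBridgeFreeEnergy_le_log_of_geometric 1 (y := (2 : ℝ)) (C := 2 ^ 41) (by norm_num) (by norm_num)
      (by norm_num) fun N => (pulledBridgeZ_le_driftZ 2 N (by norm_num)).trans (driftZ_two_upper N)⟩

/-- The free-energy window at the tilt `y = 3` (`ℤ²`): `log(10000 / 2145) ≤ λ_B(3) ≤ log(13989287 / 3000000)`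
(span-1 Kraft lower bound; `Z^B ≤ Z` and the width-16 finite-memory certificate). Computational edition.
[cite: Beaton2015, Lemma 2, Theorem 1; PonitzTittmann2000, §3] -/
theorem freeEnergyWindow_three :
    Real.log (10000 / 2145) ≤ pulledBridgeFreeEnergy 2 (3 : ℝ) ∧
      pulledBridgeFreeEnergy 2 (3 : ℝ) ≤ Real.log (13989287 / 3000000) :=
  ⟨log_le_pulledBridgeFreeEnergy_of_exists (by norm_num) (by norm_num) pulledBridgeZ_three_lower_sharp,
    pulledBridgeFreeEnergy_le_log_of_geometric 1 (y := (3 : ℝ)) (C := 2 ^ 41) (by norm_num) (by norm_num)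
      (by norm_num) fun N => (pulledBridgeZ_le_driftZ 2 N (by norm_num)).trans (driftZ_three_upper N)⟩

/-- The free-energy window at the tilt `y = 256/81` (`ℤ²`): `log(10000 / 2070) ≤ λ_B(256/81) ≤ log(100199329268 / 20736000000)`
(span-1 Kraft lower bound; `Z^B ≤ Z` and the width-16 finite-memory certificate). Computational edition.
[cite: Beaton2015, Lemma 2, Theorem 1; PonitzTittmann2000, §3] -/
theorem freeEnergyWindow_r256_81 :
    Real.log (10000 / 2070) ≤ pulledBridgeFreeEnergy 2 ((256 : ℝ) / 81) ∧
      pulledBridgeFreeEnergy 2 ((256 : ℝ) / 81) ≤ Real.log (100199329268 / 20736000000) :=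
  ⟨log_le_pulledBridgeFreeEnergy_of_exists (by norm_num) (by norm_num) pulledBridgeZ_r256_81_lower_sharp,
    pulledBridgeFreeEnergy_le_log_of_geometric 1 (y := ((256 : ℝ) / 81)) (C := 2 ^ 41) (by norm_num) (by norm_num)
      (by norm_num) fun N => (pulledBridgeZ_le_driftZ 2 N (by norm_num)).trans (driftZ_r256_81_upper N)⟩

/-- The free-energy window at the tilt `y = 4` (`ℤ²`): `log(10000 / 1752) ≤ λ_B(4) ≤ log(22843177 / 4000000)`
(span-1 Kraft lower bound; `Z^B ≤ Z` and the width-16 finite-memory certificate). Computational edition.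
[cite: Beaton2015, Lemma 2, Theorem 1; PonitzTittmann2000, §3] -/
theorem freeEnergyWindow_four :
    Real.log (10000 / 1752) ≤ pulledBridgeFreeEnergy 2 (4 : ℝ) ∧
      pulledBridgeFreeEnergy 2 (4 : ℝ) ≤ Real.log (22843177 / 4000000) :=
  ⟨log_le_pulledBridgeFreeEnergy_of_exists (by norm_num) (by norm_num) pulledBridgeZ_four_lower_sharp,
    pulledBridgeFreeEnergy_le_log_of_geometric 1 (y := (4 : ℝ)) (C := 2 ^ 41) (by norm_num) (by norm_num)
      (by norm_num) fun N => (pulledBridgeZ_le_driftZ 2 N (by norm_num)).trans (driftZ_four_upper N)⟩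

/-- **Zero-force extension `≤ 5/13`** (`ℤ²`): for `1 < y ≤ 11/9`, `λ_B(y) ≤ log μ + (5/13) log y`, i.e. every
zero-force secant up to the tilt `11/9` has slope `≤ 5/13` (certificate `(U_{11/9}/2.604)^{13} ≤ (11/9)^5`); hence the
right-derivative of `s ↦ λ_B(e^s)` at `s = 0` is at most `5/13` (DC–H 2013 says it is `0`:
`pulledBridgeFreeEnergy_exp_le_of_bridgeNotBallistic`). Computational edition.
[cite: Beaton2015, Theorem 1; DuminilCopinHammond2013, §2.4] -/
theorem zeroForce_secant_le_five_thirteenths {y : ℝ} (hy : 1 < y) (hy' : y ≤ (11 : ℝ) / 9) :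
    (pulledBridgeFreeEnergy 2 y - Real.log (connectiveConstant 2)) / Real.log y ≤ (5 : ℝ) / 13 := by
  have hmono : (pulledBridgeFreeEnergy 2 y - Real.log (connectiveConstant 2)) / Real.log y ≤
      (pulledBridgeFreeEnergy 2 ((11 : ℝ) / 9) - Real.log (connectiveConstant 2)) / Real.log ((11 : ℝ) / 9) := by
    rcases hy'.lt_or_eq with h | h
    · exact zeroForce_secant_mono 1 hy h
    · rw [h]
  refine hmono.trans ?_
  have hW1 := freeEnergyWindow_one
  have hW := freeEnergyWindow_r11_9
  rw [pulledBridgeFreeEnergy_one 1] at hW1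
  have hcert : (13 : ℝ) * (Real.log (278379899 / 99000000) - Real.log (2604 / 1000)) ≤
      5 * (Real.log ((11 : ℝ) / 9) - Real.log 1) := by
    exact_mod_cast log_cert_upper 5 13 (y₀ := (1 : ℝ)) (z := (11 : ℝ) / 9) (L₀ := 2604 / 1000)
      (Uz := 278379899 / 99000000) (by norm_num) (by norm_num) (by norm_num) (by norm_num) (by norm_num)
  rw [Real.log_one, sub_zero] at hcert
  rw [div_le_iff₀ (Real.log_pos (by norm_num))]
  linarith [hW1.1, hW.2]

/-- **Zero-force extension `≤ 5/13`, free-energy form** (`ℤ²`): `λ_B(y) ≤ log μ + (5/13) log y` for `1 ≤ y ≤ 11/9`.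
Computational edition. [cite: Beaton2015, Theorem 1] -/
theorem pulledBridgeFreeEnergy_le_near_one {y : ℝ} (hy : 1 ≤ y) (hy' : y ≤ (11 : ℝ) / 9) :
    pulledBridgeFreeEnergy 2 y ≤ Real.log (connectiveConstant 2) + 5 / 13 * Real.log y := by
  rcases hy.lt_or_eq with h | h
  · have := zeroForce_secant_le_five_thirteenths h hy'
    rw [div_le_iff₀ (Real.log_pos h)] at this
    linarith
  · rw [← h, Real.log_one, mul_zero, add_zero, pulledBridgeFreeEnergy_one 1]

/-- **Zero-force mean span `≤ 5/13 + ε` per step** (`ℤ²`, unconditional): for every `ε > 0`, eventually in `N`,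
`E^{B,1}_N[span]/N ≤ 5/13 + ε` (uniform bridges). Computational edition. [cite: Beaton2015, Theorem 1] -/
theorem eventually_pulledMeanSpan_one_le {ε : ℝ} (hε : 0 < ε) :
    ∀ᶠ N : ℕ in atTop, pulledMeanSpan 2 N 1 / N ≤ 5 / 13 + ε := by
  have h := zeroForce_secant_le_five_thirteenths (y := (11 : ℝ) / 9) (by norm_num) le_rfl
  rw [← pulledBridgeFreeEnergy_one 1, ← sub_zero (Real.log ((11 : ℝ) / 9)), ← Real.log_one] at h
  filter_upwards [eventually_pulledMeanSpan_div_le 1 (y := (1 : ℝ)) (y' := (11 : ℝ) / 9) one_pos (by norm_num) hε]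
    with N hN
  exact hN.trans (by linarith)

/-- **Force–extension at the tilt `y₀ = 11/9`** (`ℤ²`; computational edition): the window secants
`5/26 ≤ (λ_B(11/9) - λ_B(1))/log((11/9)/(1))` and
`(λ_B(z) - λ_B(11/9))/log(z/(11/9)) ≤ 8/17` (`z` the next tilt); hence every right secant at `y₀` has
slope `≥ 5/26`, every left secant has slope `≤ 8/17`, and the mean extension per step satisfies
`5/26 - ε ≤ E^{B,11/9}_N[span]/N ≤ 8/17 + ε` for all large `N`. [cite: Beaton2015, §2 (λ(y)), Theorem 1] -/
theorem forceExtension_r11_9 :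
    ((5 : ℝ) / 26 ≤ (pulledBridgeFreeEnergy 2 ((11 : ℝ) / 9) - pulledBridgeFreeEnergy 2 (1 : ℝ)) /
      (Real.log ((11 : ℝ) / 9) - Real.log (1 : ℝ))) ∧
    ((pulledBridgeFreeEnergy 2 ((3 : ℝ) / 2) - pulledBridgeFreeEnergy 2 ((11 : ℝ) / 9)) /
      (Real.log ((3 : ℝ) / 2) - Real.log ((11 : ℝ) / 9)) ≤ (8 : ℝ) / 17) ∧
    (∀ y : ℝ, ((11 : ℝ) / 9) < y → (5 : ℝ) / 26 ≤
      (pulledBridgeFreeEnergy 2 y - pulledBridgeFreeEnergy 2 ((11 : ℝ) / 9)) / (Real.log y - Real.log ((11 : ℝ) / 9))) ∧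
    (∀ y : ℝ, 0 < y → y < ((11 : ℝ) / 9) →
      (pulledBridgeFreeEnergy 2 ((11 : ℝ) / 9) - pulledBridgeFreeEnergy 2 y) / (Real.log ((11 : ℝ) / 9) - Real.log y) ≤
        (8 : ℝ) / 17) ∧
    (∀ ε : ℝ, 0 < ε → ∀ᶠ N : ℕ in atTop, (5 : ℝ) / 26 - ε ≤ pulledMeanSpan 2 N ((11 : ℝ) / 9) / N ∧
      pulledMeanSpan 2 N ((11 : ℝ) / 9) / N ≤ (8 : ℝ) / 17 + ε) := by
  have hc1 :
      (5 : ℝ) * (Real.log ((11 : ℝ) / 9) - Real.log (1 : ℝ)) ≤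
        26 * (Real.log (10000 / 3577) - Real.log (2688 / 1000)) := by
    exact_mod_cast log_cert_lower 5 26 (x := (1 : ℝ)) (y₀ := ((11 : ℝ) / 9)) (L₀ := 10000 / 3577)
      (Ux := 2688 / 1000) (by norm_num) (by norm_num) (by norm_num) (by norm_num) (by norm_num)
  have hc2 :
      (17 : ℝ) * (Real.log (18470750 / 6000000) - Real.log (10000 / 3577)) ≤
        8 * (Real.log ((3 : ℝ) / 2) - Real.log ((11 : ℝ) / 9)) := by
    exact_mod_cast log_cert_upper 8 17 (y₀ := ((11 : ℝ) / 9)) (z := ((3 : ℝ) / 2)) (L₀ := 10000 / 3577)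
      (Uz := 18470750 / 6000000) (by norm_num) (by norm_num) (by norm_num) (by norm_num) (by norm_num)
  have hS1 : (5 : ℝ) / 26 ≤ (pulledBridgeFreeEnergy 2 ((11 : ℝ) / 9) - pulledBridgeFreeEnergy 2 (1 : ℝ)) /
      (Real.log ((11 : ℝ) / 9) - Real.log (1 : ℝ)) :=
    secant_ge_of_window 1 (by norm_num) (by norm_num) (by norm_num) freeEnergyWindow_r11_9.1
      freeEnergyWindow_one.2 hc1
  have hS2 : (pulledBridgeFreeEnergy 2 ((3 : ℝ) / 2) - pulledBridgeFreeEnergy 2 ((11 : ℝ) / 9)) /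
      (Real.log ((3 : ℝ) / 2) - Real.log ((11 : ℝ) / 9)) ≤ (8 : ℝ) / 17 :=
    secant_le_of_window 1 (by norm_num) (by norm_num) (by norm_num) freeEnergyWindow_r11_9.1
      freeEnergyWindow_r3_2.2 hc2
  exact ⟨hS1, hS2, fun y hy => hS1.trans (pulledBridgeFreeEnergy_secant_mono 1 (by norm_num) (by norm_num) hy),
    fun y hy0 hy => (pulledBridgeFreeEnergy_secant_mono 1 hy0 hy (by norm_num : ((11 : ℝ) / 9) < ((3 : ℝ) / 2))).trans hS2,
    fun ε hε => eventually_pulledMeanSpan_window 1 (by norm_num) (by norm_num) (by norm_num) hS1 hS2 hε⟩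

/-- **Force–extension at the tilt `y₀ = 3/2`** (`ℤ²`; computational edition): the window secants
`7/16 ≤ (λ_B(3/2) - λ_B(11/9))/log((3/2)/(11/9))` and
`(λ_B(z) - λ_B(3/2))/log(z/(3/2)) ≤ 10/19` (`z` the next tilt); hence every right secant at `y₀` has
slope `≥ 7/16`, every left secant has slope `≤ 10/19`, and the mean extension per step satisfies
`7/16 - ε ≤ E^{B,3/2}_N[span]/N ≤ 10/19 + ε` for all large `N`. [cite: Beaton2015, §2 (λ(y)), Theorem 1] -/
theorem forceExtension_r3_2 :
    ((7 : ℝ) / 16 ≤ (pulledBridgeFreeEnergy 2 ((3 : ℝ) / 2) - pulledBridgeFreeEnergy 2 ((11 : ℝ) / 9)) /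
      (Real.log ((3 : ℝ) / 2) - Real.log ((11 : ℝ) / 9))) ∧
    ((pulledBridgeFreeEnergy 2 ((25 : ℝ) / 16) - pulledBridgeFreeEnergy 2 ((3 : ℝ) / 2)) /
      (Real.log ((25 : ℝ) / 16) - Real.log ((3 : ℝ) / 2)) ≤ (10 : ℝ) / 19) ∧
    (∀ y : ℝ, ((3 : ℝ) / 2) < y → (7 : ℝ) / 16 ≤
      (pulledBridgeFreeEnergy 2 y - pulledBridgeFreeEnergy 2 ((3 : ℝ) / 2)) / (Real.log y - Real.log ((3 : ℝ) / 2))) ∧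
    (∀ y : ℝ, 0 < y → y < ((3 : ℝ) / 2) →
      (pulledBridgeFreeEnergy 2 ((3 : ℝ) / 2) - pulledBridgeFreeEnergy 2 y) / (Real.log ((3 : ℝ) / 2) - Real.log y) ≤
        (10 : ℝ) / 19) ∧
    (∀ ε : ℝ, 0 < ε → ∀ᶠ N : ℕ in atTop, (7 : ℝ) / 16 - ε ≤ pulledMeanSpan 2 N ((3 : ℝ) / 2) / N ∧
      pulledMeanSpan 2 N ((3 : ℝ) / 2) / N ≤ (10 : ℝ) / 19 + ε) := by
  have hc1 :
      (7 : ℝ) * (Real.log ((3 : ℝ) / 2) - Real.log ((11 : ℝ) / 9)) ≤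
        16 * (Real.log (10000 / 3251) - Real.log (278379899 / 99000000)) := by
    exact_mod_cast log_cert_lower 7 16 (x := ((11 : ℝ) / 9)) (y₀ := ((3 : ℝ) / 2)) (L₀ := 10000 / 3251)
      (Ux := 278379899 / 99000000) (by norm_num) (by norm_num) (by norm_num) (by norm_num) (by norm_num)
  have hc2 :
      (19 : ℝ) * (Real.log (1257057670 / 400000000) - Real.log (10000 / 3251)) ≤
        10 * (Real.log ((25 : ℝ) / 16) - Real.log ((3 : ℝ) / 2)) := by
    exact_mod_cast log_cert_upper 10 19 (y₀ := ((3 : ℝ) / 2)) (z := ((25 : ℝ) / 16)) (L₀ := 10000 / 3251)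
      (Uz := 1257057670 / 400000000) (by norm_num) (by norm_num) (by norm_num) (by norm_num) (by norm_num)
  have hS1 : (7 : ℝ) / 16 ≤ (pulledBridgeFreeEnergy 2 ((3 : ℝ) / 2) - pulledBridgeFreeEnergy 2 ((11 : ℝ) / 9)) /
      (Real.log ((3 : ℝ) / 2) - Real.log ((11 : ℝ) / 9)) :=
    secant_ge_of_window 1 (by norm_num) (by norm_num) (by norm_num) freeEnergyWindow_r3_2.1
      freeEnergyWindow_r11_9.2 hc1
  have hS2 : (pulledBridgeFreeEnergy 2 ((25 : ℝ) / 16) - pulledBridgeFreeEnergy 2 ((3 : ℝ) / 2)) /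
      (Real.log ((25 : ℝ) / 16) - Real.log ((3 : ℝ) / 2)) ≤ (10 : ℝ) / 19 :=
    secant_le_of_window 1 (by norm_num) (by norm_num) (by norm_num) freeEnergyWindow_r3_2.1
      freeEnergyWindow_r25_16.2 hc2
  exact ⟨hS1, hS2, fun y hy => hS1.trans (pulledBridgeFreeEnergy_secant_mono 1 (by norm_num) (by norm_num) hy),
    fun y hy0 hy => (pulledBridgeFreeEnergy_secant_mono 1 hy0 hy (by norm_num : ((3 : ℝ) / 2) < ((25 : ℝ) / 16))).trans hS2,
    fun ε hε => eventually_pulledMeanSpan_window 1 (by norm_num) (by norm_num) (by norm_num) hS1 hS2 hε⟩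

/-- **Force–extension at the tilt `y₀ = 25/16`** (`ℤ²`; computational edition): the window secants
`24/49 ≤ (λ_B(25/16) - λ_B(3/2))/log((25/16)/(3/2))` and
`(λ_B(z) - λ_B(25/16))/log(z/(25/16)) ≤ 5/9` (`z` the next tilt); hence every right secant at `y₀` has
slope `≥ 24/49`, every left secant has slope `≤ 5/9`, and the mean extension per step satisfies
`24/49 - ε ≤ E^{B,25/16}_N[span]/N ≤ 5/9 + ε` for all large `N`. [cite: Beaton2015, §2 (λ(y)), Theorem 1] -/
theorem forceExtension_r25_16 :
    ((24 : ℝ) / 49 ≤ (pulledBridgeFreeEnergy 2 ((25 : ℝ) / 16) - pulledBridgeFreeEnergy 2 ((3 : ℝ) / 2)) /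
      (Real.log ((25 : ℝ) / 16) - Real.log ((3 : ℝ) / 2))) ∧
    ((pulledBridgeFreeEnergy 2 ((125 : ℝ) / 64) - pulledBridgeFreeEnergy 2 ((25 : ℝ) / 16)) /
      (Real.log ((125 : ℝ) / 64) - Real.log ((25 : ℝ) / 16)) ≤ (5 : ℝ) / 9) ∧
    (∀ y : ℝ, ((25 : ℝ) / 16) < y → (24 : ℝ) / 49 ≤
      (pulledBridgeFreeEnergy 2 y - pulledBridgeFreeEnergy 2 ((25 : ℝ) / 16)) / (Real.log y - Real.log ((25 : ℝ) / 16))) ∧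
    (∀ y : ℝ, 0 < y → y < ((25 : ℝ) / 16) →
      (pulledBridgeFreeEnergy 2 ((25 : ℝ) / 16) - pulledBridgeFreeEnergy 2 y) / (Real.log ((25 : ℝ) / 16) - Real.log y) ≤
        (5 : ℝ) / 9) ∧
    (∀ ε : ℝ, 0 < ε → ∀ᶠ N : ℕ in atTop, (24 : ℝ) / 49 - ε ≤ pulledMeanSpan 2 N ((25 : ℝ) / 16) / N ∧
      pulledMeanSpan 2 N ((25 : ℝ) / 16) / N ≤ (5 : ℝ) / 9 + ε) := by
  have hc1 :
      (24 : ℝ) * (Real.log ((25 : ℝ) / 16) - Real.log ((3 : ℝ) / 2)) ≤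
        49 * (Real.log (10000 / 3184) - Real.log (18470750 / 6000000)) := by
    exact_mod_cast log_cert_lower 24 49 (x := ((3 : ℝ) / 2)) (y₀ := ((25 : ℝ) / 16)) (L₀ := 10000 / 3184)
      (Ux := 18470750 / 6000000) (by norm_num) (by norm_num) (by norm_num) (by norm_num) (by norm_num)
  have hc2 :
      (9 : ℝ) * (Real.log (28426068191 / 8000000000) - Real.log (10000 / 3184)) ≤
        5 * (Real.log ((125 : ℝ) / 64) - Real.log ((25 : ℝ) / 16)) := by
    exact_mod_cast log_cert_upper 5 9 (y₀ := ((25 : ℝ) / 16)) (z := ((125 : ℝ) / 64)) (L₀ := 10000 / 3184)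
      (Uz := 28426068191 / 8000000000) (by norm_num) (by norm_num) (by norm_num) (by norm_num) (by norm_num)
  have hS1 : (24 : ℝ) / 49 ≤ (pulledBridgeFreeEnergy 2 ((25 : ℝ) / 16) - pulledBridgeFreeEnergy 2 ((3 : ℝ) / 2)) /
      (Real.log ((25 : ℝ) / 16) - Real.log ((3 : ℝ) / 2)) :=
    secant_ge_of_window 1 (by norm_num) (by norm_num) (by norm_num) freeEnergyWindow_r25_16.1
      freeEnergyWindow_r3_2.2 hc1
  have hS2 : (pulledBridgeFreeEnergy 2 ((125 : ℝ) / 64) - pulledBridgeFreeEnergy 2 ((25 : ℝ) / 16)) /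
      (Real.log ((125 : ℝ) / 64) - Real.log ((25 : ℝ) / 16)) ≤ (5 : ℝ) / 9 :=
    secant_le_of_window 1 (by norm_num) (by norm_num) (by norm_num) freeEnergyWindow_r25_16.1
      freeEnergyWindow_r125_64.2 hc2
  exact ⟨hS1, hS2, fun y hy => hS1.trans (pulledBridgeFreeEnergy_secant_mono 1 (by norm_num) (by norm_num) hy),
    fun y hy0 hy => (pulledBridgeFreeEnergy_secant_mono 1 hy0 hy (by norm_num : ((25 : ℝ) / 16) < ((125 : ℝ) / 64))).trans hS2,
    fun ε hε => eventually_pulledMeanSpan_window 1 (by norm_num) (by norm_num) (by norm_num) hS1 hS2 hε⟩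

/-- **Force–extension at the tilt `y₀ = 125/64`** (`ℤ²`; computational edition): the window secants
`6/11 ≤ (λ_B(125/64) - λ_B(25/16))/log((125/64)/(25/16))` and
`(λ_B(z) - λ_B(125/64))/log(z/(125/64)) ≤ 3/5` (`z` the next tilt); hence every right secant at `y₀` has
slope `≥ 6/11`, every left secant has slope `≤ 3/5`, and the mean extension per step satisfies
`6/11 - ε ≤ E^{B,125/64}_N[span]/N ≤ 3/5 + ε` for all large `N`. [cite: Beaton2015, §2 (λ(y)), Theorem 1] -/
theorem forceExtension_r125_64 :
    ((6 : ℝ) / 11 ≤ (pulledBridgeFreeEnergy 2 ((125 : ℝ) / 64) - pulledBridgeFreeEnergy 2 ((25 : ℝ) / 16)) /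
      (Real.log ((125 : ℝ) / 64) - Real.log ((25 : ℝ) / 16))) ∧
    ((pulledBridgeFreeEnergy 2 (2 : ℝ) - pulledBridgeFreeEnergy 2 ((125 : ℝ) / 64)) /
      (Real.log (2 : ℝ) - Real.log ((125 : ℝ) / 64)) ≤ (3 : ℝ) / 5) ∧
    (∀ y : ℝ, ((125 : ℝ) / 64) < y → (6 : ℝ) / 11 ≤
      (pulledBridgeFreeEnergy 2 y - pulledBridgeFreeEnergy 2 ((125 : ℝ) / 64)) / (Real.log y - Real.log ((125 : ℝ) / 64))) ∧
    (∀ y : ℝ, 0 < y → y < ((125 : ℝ) / 64) →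
      (pulledBridgeFreeEnergy 2 ((125 : ℝ) / 64) - pulledBridgeFreeEnergy 2 y) / (Real.log ((125 : ℝ) / 64) - Real.log y) ≤
        (3 : ℝ) / 5) ∧
    (∀ ε : ℝ, 0 < ε → ∀ᶠ N : ℕ in atTop, (6 : ℝ) / 11 - ε ≤ pulledMeanSpan 2 N ((125 : ℝ) / 64) / N ∧
      pulledMeanSpan 2 N ((125 : ℝ) / 64) / N ≤ (3 : ℝ) / 5 + ε) := by
  have hc1 :
      (6 : ℝ) * (Real.log ((125 : ℝ) / 64) - Real.log ((25 : ℝ) / 16)) ≤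
        11 * (Real.log (10000 / 2815) - Real.log (1257057670 / 400000000)) := by
    exact_mod_cast log_cert_lower 6 11 (x := ((25 : ℝ) / 16)) (y₀ := ((125 : ℝ) / 64)) (L₀ := 10000 / 2815)
      (Ux := 1257057670 / 400000000) (by norm_num) (by norm_num) (by norm_num) (by norm_num) (by norm_num)
  have hc2 :
      (5 : ℝ) * (Real.log (7206013 / 2000000) - Real.log (10000 / 2815)) ≤
        3 * (Real.log (2 : ℝ) - Real.log ((125 : ℝ) / 64)) := by
    exact_mod_cast log_cert_upper 3 5 (y₀ := ((125 : ℝ) / 64)) (z := (2 : ℝ)) (L₀ := 10000 / 2815)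
      (Uz := 7206013 / 2000000) (by norm_num) (by norm_num) (by norm_num) (by norm_num) (by norm_num)
  have hS1 : (6 : ℝ) / 11 ≤ (pulledBridgeFreeEnergy 2 ((125 : ℝ) / 64) - pulledBridgeFreeEnergy 2 ((25 : ℝ) / 16)) /
      (Real.log ((125 : ℝ) / 64) - Real.log ((25 : ℝ) / 16)) :=
    secant_ge_of_window 1 (by norm_num) (by norm_num) (by norm_num) freeEnergyWindow_r125_64.1
      freeEnergyWindow_r25_16.2 hc1
  have hS2 : (pulledBridgeFreeEnergy 2 (2 : ℝ) - pulledBridgeFreeEnergy 2 ((125 : ℝ) / 64)) /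
      (Real.log (2 : ℝ) - Real.log ((125 : ℝ) / 64)) ≤ (3 : ℝ) / 5 :=
    secant_le_of_window 1 (by norm_num) (by norm_num) (by norm_num) freeEnergyWindow_r125_64.1
      freeEnergyWindow_two.2 hc2
  exact ⟨hS1, hS2, fun y hy => hS1.trans (pulledBridgeFreeEnergy_secant_mono 1 (by norm_num) (by norm_num) hy),
    fun y hy0 hy => (pulledBridgeFreeEnergy_secant_mono 1 hy0 hy (by norm_num : ((125 : ℝ) / 64) < (2 : ℝ))).trans hS2,
    fun ε hε => eventually_pulledMeanSpan_window 1 (by norm_num) (by norm_num) (by norm_num) hS1 hS2 hε⟩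

/-- **Force–extension at the tilt `y₀ = 2`** (`ℤ²`; computational edition): the window secants
`15/26 ≤ (λ_B(2) - λ_B(125/64))/log((2)/(125/64))` and
`(λ_B(z) - λ_B(2))/log(z/(2)) ≤ 16/25` (`z` the next tilt); hence every right secant at `y₀` has
slope `≥ 15/26`, every left secant has slope `≤ 16/25`, and the mean extension per step satisfies
`15/26 - ε ≤ E^{B,2}_N[span]/N ≤ 16/25 + ε` for all large `N`. [cite: Beaton2015, §2 (λ(y)), Theorem 1] -/
theorem forceExtension_two :
    ((15 : ℝ) / 26 ≤ (pulledBridgeFreeEnergy 2 (2 : ℝ) - pulledBridgeFreeEnergy 2 ((125 : ℝ) / 64)) /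
      (Real.log (2 : ℝ) - Real.log ((125 : ℝ) / 64))) ∧
    ((pulledBridgeFreeEnergy 2 (3 : ℝ) - pulledBridgeFreeEnergy 2 (2 : ℝ)) /
      (Real.log (3 : ℝ) - Real.log (2 : ℝ)) ≤ (16 : ℝ) / 25) ∧
    (∀ y : ℝ, (2 : ℝ) < y → (15 : ℝ) / 26 ≤
      (pulledBridgeFreeEnergy 2 y - pulledBridgeFreeEnergy 2 (2 : ℝ)) / (Real.log y - Real.log (2 : ℝ))) ∧
    (∀ y : ℝ, 0 < y → y < (2 : ℝ) →
      (pulledBridgeFreeEnergy 2 (2 : ℝ) - pulledBridgeFreeEnergy 2 y) / (Real.log (2 : ℝ) - Real.log y) ≤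
        (16 : ℝ) / 25) ∧
    (∀ ε : ℝ, 0 < ε → ∀ᶠ N : ℕ in atTop, (15 : ℝ) / 26 - ε ≤ pulledMeanSpan 2 N (2 : ℝ) / N ∧
      pulledMeanSpan 2 N (2 : ℝ) / N ≤ (16 : ℝ) / 25 + ε) := by
  have hc1 :
      (15 : ℝ) * (Real.log (2 : ℝ) - Real.log ((125 : ℝ) / 64)) ≤
        26 * (Real.log (1250 / 347) - Real.log (28426068191 / 8000000000)) := by
    exact_mod_cast log_cert_lower 15 26 (x := ((125 : ℝ) / 64)) (y₀ := (2 : ℝ)) (L₀ := 1250 / 347)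
      (Ux := 28426068191 / 8000000000) (by norm_num) (by norm_num) (by norm_num) (by norm_num) (by norm_num)
  have hc2 :
      (25 : ℝ) * (Real.log (13989287 / 3000000) - Real.log (1250 / 347)) ≤
        16 * (Real.log (3 : ℝ) - Real.log (2 : ℝ)) := by
    exact_mod_cast log_cert_upper 16 25 (y₀ := (2 : ℝ)) (z := (3 : ℝ)) (L₀ := 1250 / 347)
      (Uz := 13989287 / 3000000) (by norm_num) (by norm_num) (by norm_num) (by norm_num) (by norm_num)
  have hS1 : (15 : ℝ) / 26 ≤ (pulledBridgeFreeEnergy 2 (2 : ℝ) - pulledBridgeFreeEnergy 2 ((125 : ℝ) / 64)) /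
      (Real.log (2 : ℝ) - Real.log ((125 : ℝ) / 64)) :=
    secant_ge_of_window 1 (by norm_num) (by norm_num) (by norm_num) freeEnergyWindow_two.1
      freeEnergyWindow_r125_64.2 hc1
  have hS2 : (pulledBridgeFreeEnergy 2 (3 : ℝ) - pulledBridgeFreeEnergy 2 (2 : ℝ)) /
      (Real.log (3 : ℝ) - Real.log (2 : ℝ)) ≤ (16 : ℝ) / 25 :=
    secant_le_of_window 1 (by norm_num) (by norm_num) (by norm_num) freeEnergyWindow_two.1
      freeEnergyWindow_three.2 hc2
  exact ⟨hS1, hS2, fun y hy => hS1.trans (pulledBridgeFreeEnergy_secant_mono 1 (by norm_num) (by norm_num) hy),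
    fun y hy0 hy => (pulledBridgeFreeEnergy_secant_mono 1 hy0 hy (by norm_num : (2 : ℝ) < (3 : ℝ))).trans hS2,
    fun ε hε => eventually_pulledMeanSpan_window 1 (by norm_num) (by norm_num) (by norm_num) hS1 hS2 hε⟩

/-- **Force–extension at the tilt `y₀ = 3`** (`ℤ²`; computational edition): the window secants
`19/30 ≤ (λ_B(3) - λ_B(2))/log((3)/(2))` and
`(λ_B(z) - λ_B(3))/log(z/(3)) ≤ 20/29` (`z` the next tilt); hence every right secant at `y₀` has
slope `≥ 19/30`, every left secant has slope `≤ 20/29`, and the mean extension per step satisfies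
`19/30 - ε ≤ E^{B,3}_N[span]/N ≤ 20/29 + ε` for all large `N`. [cite: Beaton2015, §2 (λ(y)), Theorem 1] -/
theorem forceExtension_three :
    ((19 : ℝ) / 30 ≤ (pulledBridgeFreeEnergy 2 (3 : ℝ) - pulledBridgeFreeEnergy 2 (2 : ℝ)) /
      (Real.log (3 : ℝ) - Real.log (2 : ℝ))) ∧
    ((pulledBridgeFreeEnergy 2 ((256 : ℝ) / 81) - pulledBridgeFreeEnergy 2 (3 : ℝ)) /
      (Real.log ((256 : ℝ) / 81) - Real.log (3 : ℝ)) ≤ (20 : ℝ) / 29) ∧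
    (∀ y : ℝ, (3 : ℝ) < y → (19 : ℝ) / 30 ≤
      (pulledBridgeFreeEnergy 2 y - pulledBridgeFreeEnergy 2 (3 : ℝ)) / (Real.log y - Real.log (3 : ℝ))) ∧
    (∀ y : ℝ, 0 < y → y < (3 : ℝ) →
      (pulledBridgeFreeEnergy 2 (3 : ℝ) - pulledBridgeFreeEnergy 2 y) / (Real.log (3 : ℝ) - Real.log y) ≤
        (20 : ℝ) / 29) ∧
    (∀ ε : ℝ, 0 < ε → ∀ᶠ N : ℕ in atTop, (19 : ℝ) / 30 - ε ≤ pulledMeanSpan 2 N (3 : ℝ) / N ∧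
      pulledMeanSpan 2 N (3 : ℝ) / N ≤ (20 : ℝ) / 29 + ε) := by
  have hc1 :
      (19 : ℝ) * (Real.log (3 : ℝ) - Real.log (2 : ℝ)) ≤
        30 * (Real.log (10000 / 2145) - Real.log (7206013 / 2000000)) := by
    exact_mod_cast log_cert_lower 19 30 (x := (2 : ℝ)) (y₀ := (3 : ℝ)) (L₀ := 10000 / 2145)
      (Ux := 7206013 / 2000000) (by norm_num) (by norm_num) (by norm_num) (by norm_num) (by norm_num)
  have hc2 :
      (29 : ℝ) * (Real.log (100199329268 / 20736000000) - Real.log (10000 / 2145)) ≤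
        20 * (Real.log ((256 : ℝ) / 81) - Real.log (3 : ℝ)) := by
    exact_mod_cast log_cert_upper 20 29 (y₀ := (3 : ℝ)) (z := ((256 : ℝ) / 81)) (L₀ := 10000 / 2145)
      (Uz := 100199329268 / 20736000000) (by norm_num) (by norm_num) (by norm_num) (by norm_num) (by norm_num)
  have hS1 : (19 : ℝ) / 30 ≤ (pulledBridgeFreeEnergy 2 (3 : ℝ) - pulledBridgeFreeEnergy 2 (2 : ℝ)) /
      (Real.log (3 : ℝ) - Real.log (2 : ℝ)) :=
    secant_ge_of_window 1 (by norm_num) (by norm_num) (by norm_num) freeEnergyWindow_three.1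
      freeEnergyWindow_two.2 hc1
  have hS2 : (pulledBridgeFreeEnergy 2 ((256 : ℝ) / 81) - pulledBridgeFreeEnergy 2 (3 : ℝ)) /
      (Real.log ((256 : ℝ) / 81) - Real.log (3 : ℝ)) ≤ (20 : ℝ) / 29 :=
    secant_le_of_window 1 (by norm_num) (by norm_num) (by norm_num) freeEnergyWindow_three.1
      freeEnergyWindow_r256_81.2 hc2
  exact ⟨hS1, hS2, fun y hy => hS1.trans (pulledBridgeFreeEnergy_secant_mono 1 (by norm_num) (by norm_num) hy),
    fun y hy0 hy => (pulledBridgeFreeEnergy_secant_mono 1 hy0 hy (by norm_num : (3 : ℝ) < ((256 : ℝ) / 81))).trans hS2,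
    fun ε hε => eventually_pulledMeanSpan_window 1 (by norm_num) (by norm_num) (by norm_num) hS1 hS2 hε⟩

/-- **Force–extension at the tilt `y₀ = 256/81`** (`ℤ²`; computational edition): the window secants
`2/3 ≤ (λ_B(256/81) - λ_B(3))/log((256/81)/(3))` and
`(λ_B(z) - λ_B(256/81))/log(z/(256/81)) ≤ 5/7` (`z` the next tilt); hence every right secant at `y₀` has
slope `≥ 2/3`, every left secant has slope `≤ 5/7`, and the mean extension per step satisfies
`2/3 - ε ≤ E^{B,256/81}_N[span]/N ≤ 5/7 + ε` for all large `N`. [cite: Beaton2015, §2 (λ(y)), Theorem 1] -/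
theorem forceExtension_r256_81 :
    ((2 : ℝ) / 3 ≤ (pulledBridgeFreeEnergy 2 ((256 : ℝ) / 81) - pulledBridgeFreeEnergy 2 (3 : ℝ)) /
      (Real.log ((256 : ℝ) / 81) - Real.log (3 : ℝ))) ∧
    ((pulledBridgeFreeEnergy 2 (4 : ℝ) - pulledBridgeFreeEnergy 2 ((256 : ℝ) / 81)) /
      (Real.log (4 : ℝ) - Real.log ((256 : ℝ) / 81)) ≤ (5 : ℝ) / 7) ∧
    (∀ y : ℝ, ((256 : ℝ) / 81) < y → (2 : ℝ) / 3 ≤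
      (pulledBridgeFreeEnergy 2 y - pulledBridgeFreeEnergy 2 ((256 : ℝ) / 81)) / (Real.log y - Real.log ((256 : ℝ) / 81))) ∧
    (∀ y : ℝ, 0 < y → y < ((256 : ℝ) / 81) →
      (pulledBridgeFreeEnergy 2 ((256 : ℝ) / 81) - pulledBridgeFreeEnergy 2 y) / (Real.log ((256 : ℝ) / 81) - Real.log y) ≤
        (5 : ℝ) / 7) ∧
    (∀ ε : ℝ, 0 < ε → ∀ᶠ N : ℕ in atTop, (2 : ℝ) / 3 - ε ≤ pulledMeanSpan 2 N ((256 : ℝ) / 81) / N ∧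
      pulledMeanSpan 2 N ((256 : ℝ) / 81) / N ≤ (5 : ℝ) / 7 + ε) := by
  have hc1 :
      (2 : ℝ) * (Real.log ((256 : ℝ) / 81) - Real.log (3 : ℝ)) ≤
        3 * (Real.log (10000 / 2070) - Real.log (13989287 / 3000000)) := by
    exact_mod_cast log_cert_lower 2 3 (x := (3 : ℝ)) (y₀ := ((256 : ℝ) / 81)) (L₀ := 10000 / 2070)
      (Ux := 13989287 / 3000000) (by norm_num) (by norm_num) (by norm_num) (by norm_num) (by norm_num)
  have hc2 :
      (7 : ℝ) * (Real.log (22843177 / 4000000) - Real.log (10000 / 2070)) ≤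
        5 * (Real.log (4 : ℝ) - Real.log ((256 : ℝ) / 81)) := by
    exact_mod_cast log_cert_upper 5 7 (y₀ := ((256 : ℝ) / 81)) (z := (4 : ℝ)) (L₀ := 10000 / 2070)
      (Uz := 22843177 / 4000000) (by norm_num) (by norm_num) (by norm_num) (by norm_num) (by norm_num)
  have hS1 : (2 : ℝ) / 3 ≤ (pulledBridgeFreeEnergy 2 ((256 : ℝ) / 81) - pulledBridgeFreeEnergy 2 (3 : ℝ)) /
      (Real.log ((256 : ℝ) / 81) - Real.log (3 : ℝ)) :=
    secant_ge_of_window 1 (by norm_num) (by norm_num) (by norm_num) freeEnergyWindow_r256_81.1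
      freeEnergyWindow_three.2 hc1
  have hS2 : (pulledBridgeFreeEnergy 2 (4 : ℝ) - pulledBridgeFreeEnergy 2 ((256 : ℝ) / 81)) /
      (Real.log (4 : ℝ) - Real.log ((256 : ℝ) / 81)) ≤ (5 : ℝ) / 7 :=
    secant_le_of_window 1 (by norm_num) (by norm_num) (by norm_num) freeEnergyWindow_r256_81.1
      freeEnergyWindow_four.2 hc2
  exact ⟨hS1, hS2, fun y hy => hS1.trans (pulledBridgeFreeEnergy_secant_mono 1 (by norm_num) (by norm_num) hy),
    fun y hy0 hy => (pulledBridgeFreeEnergy_secant_mono 1 hy0 hy (by norm_num : ((256 : ℝ) / 81) < (4 : ℝ))).trans hS2,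
    fun ε hε => eventually_pulledMeanSpan_window 1 (by norm_num) (by norm_num) (by norm_num) hS1 hS2 hε⟩

/-- **Force–extension at the tilt `y₀ = 4`** (`ℤ²`; computational edition): the window secants
`12/17 ≤ (λ_B(4) - λ_B(256/81))/log((4)/(256/81))` and
`(λ_B(z) - λ_B(4))/log(z/(4)) ≤ 1` (`z` the next tilt); hence every right secant at `y₀` has
slope `≥ 12/17`, every left secant has slope `≤ 1`, and the mean extension per step satisfies
`12/17 - ε ≤ E^{B,4}_N[span]/N ≤ 1 + ε` for all large `N`. [cite: Beaton2015, §2 (λ(y)), Theorem 1] -/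
theorem forceExtension_four :
    ((12 : ℝ) / 17 ≤ (pulledBridgeFreeEnergy 2 (4 : ℝ) - pulledBridgeFreeEnergy 2 ((256 : ℝ) / 81)) /
      (Real.log (4 : ℝ) - Real.log ((256 : ℝ) / 81))) ∧
    ((pulledBridgeFreeEnergy 2 (5 : ℝ) - pulledBridgeFreeEnergy 2 (4 : ℝ)) /
      (Real.log (5 : ℝ) - Real.log (4 : ℝ)) ≤ (1 : ℝ)) ∧
    (∀ y : ℝ, (4 : ℝ) < y → (12 : ℝ) / 17 ≤
      (pulledBridgeFreeEnergy 2 y - pulledBridgeFreeEnergy 2 (4 : ℝ)) / (Real.log y - Real.log (4 : ℝ))) ∧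
    (∀ y : ℝ, 0 < y → y < (4 : ℝ) →
      (pulledBridgeFreeEnergy 2 (4 : ℝ) - pulledBridgeFreeEnergy 2 y) / (Real.log (4 : ℝ) - Real.log y) ≤
        (1 : ℝ)) ∧
    (∀ ε : ℝ, 0 < ε → ∀ᶠ N : ℕ in atTop, (12 : ℝ) / 17 - ε ≤ pulledMeanSpan 2 N (4 : ℝ) / N ∧
      pulledMeanSpan 2 N (4 : ℝ) / N ≤ (1 : ℝ) + ε) := by
  have hc1 :
      (12 : ℝ) * (Real.log (4 : ℝ) - Real.log ((256 : ℝ) / 81)) ≤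
        17 * (Real.log (10000 / 1752) - Real.log (100199329268 / 20736000000)) := by
    exact_mod_cast log_cert_lower 12 17 (x := ((256 : ℝ) / 81)) (y₀ := (4 : ℝ)) (L₀ := 10000 / 1752)
      (Ux := 100199329268 / 20736000000) (by norm_num) (by norm_num) (by norm_num) (by norm_num) (by norm_num)
  have hc2 :
      True := trivial
  have hS1 : (12 : ℝ) / 17 ≤ (pulledBridgeFreeEnergy 2 (4 : ℝ) - pulledBridgeFreeEnergy 2 ((256 : ℝ) / 81)) /
      (Real.log (4 : ℝ) - Real.log ((256 : ℝ) / 81)) :=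
    secant_ge_of_window 1 (by norm_num) (by norm_num) (by norm_num) freeEnergyWindow_four.1
      freeEnergyWindow_r256_81.2 hc1
  have hS2 : (pulledBridgeFreeEnergy 2 (5 : ℝ) - pulledBridgeFreeEnergy 2 (4 : ℝ)) /
      (Real.log (5 : ℝ) - Real.log (4 : ℝ)) ≤ (1 : ℝ) :=
    by
    rw [div_le_iff₀ (sub_pos.2 (Real.log_lt_log (by norm_num) (by norm_num))), one_mul]
    exact pulledBridgeFreeEnergy_sub_le_log_sub 1 (by norm_num) (by norm_num)
  exact ⟨hS1, hS2, fun y hy => hS1.trans (pulledBridgeFreeEnergy_secant_mono 1 (by norm_num) (by norm_num) hy),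
    fun y hy0 hy => (pulledBridgeFreeEnergy_secant_mono 1 hy0 hy (by norm_num : (4 : ℝ) < (5 : ℝ))).trans hS2,
    fun ε hε => eventually_pulledMeanSpan_window 1 (by norm_num) (by norm_num) (by norm_num) hS1 hS2 hε⟩

end Literature.Probability.RandomPlanarGeometry.SAW.Zd
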